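import Literature.NumberTheory.EllipticCurves.NoEverywhereGoodReductionRat
import Literature.NumberTheory.EllipticCurves.SupersingularPrimeFieldPointCount
import Literature.NumberTheory.EllipticCurves.ComplexMultiplicationDeuring0Square
import HarnessLib

/-!
# `a₂ = 0` for a `j = 0` curve over `ℚ` with good reduction at `2` (Deuring at the inert prime `2`, model-free)

Topic `NumberTheory/EllipticCurves`; namespace `Literature.NumberTheory.EllipticCurves.JZero` (as
`JZeroKolyvaginPrimes`). THEOREMS ONLY — no definition, no named fact, no instance (D-0014/D-0026).

For an elliptic curve `E/ℚ` with `j(E) = 0` (CM by `ℤ[ζ₃]`; the prime `2` is INERT in `ℚ(√−3)`) and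
good reduction at `2`, the `2`nd coefficient of `L(E, s)` vanishes: `a₂(E) = 0`, i.e. `#Ẽ(𝔽₂) = 3`
(supersingular reduction). By Deuring's theorem `L(E, s) = L(ψ, s)` for a Grössencharacter `ψ` of
`ℚ(√−3)`, and there is no ideal of norm `2`; the tree's pointwise statements of this vanishing
(`frobeniusTrace_eq_zero_of_j_eq_zero_of_mod_three_eq_two` in `ComplexMultiplicationDeuring0Square`,
`JZero.lFunction_eq_zero_of_j_eq_zero_of_mod_three_eq_two` in `JZeroKolyvaginPrimes`) go through the
short normal form `y² = x³ + B` and therefore EXCLUDE `p = 2`, and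
`SexticTwist.lFunction_apply_two_pow_of_eq_sixteen_mul` is bound to the model `y² = x³ + 16u`,
`u ≡ 1 (mod 4)`. This file supplies the missing prime `2` for an ARBITRARY globally minimal model,
by an elementary computation on the minimal equation (Silverman, *AEC*, III.1, App. A Prop. 1.1(c),
Ex. 5.7; V.2):

* `two_dvd_a₁_of_c₄_eq_zero` — over `ℤ`, `c₄ = 0 ⟹ 2 ∣ a₁` (`c₄ ≡ a₁⁴ (mod 2)`, Mathlib
  `c₄_of_char_two`);
* `sq_eq_three_mul_of_c₄_eq_zero` — with `a₁ = 2α`: `c₄ = 16((α² + a₂)² − 3(a₄ + α a₃))`, so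
  `c₄ = 0 ⟹ (α² + a₂)² = 3(a₄ + α a₃)`;
* `intCast_a₃_eq_one_of_c₄_eq_zero`, `intCast_a₂_eq_intCast_a₄_of_c₄_eq_zero` — if moreover `2 ∤ Δ`
  then `a₃` is odd (`Δ ≡ a₃⁴ (mod 2)` when `2 ∣ a₁`, Mathlib `Δ_of_char_two`) and `a₂ ≡ a₄ (mod 2)`;
* `natCard_point_eq_three` — over `𝔽₂`, every `y² + y = x³ + a x² + a x + b` has exactly `3` points
  (for each `x ∈ 𝔽₂` the right-hand side takes the values `b`, `1 + b`, and `y² + y = c` has `2`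
  resp. `0` solutions for `c = 0` resp. `1`);
* ★ `reductionPointCount_two_eq_three`, ★ `frobeniusTrace_two_eq_zero_of_j_eq_zero`,
  ★ `lFunction_two_eq_zero_of_j_eq_zero` — for a globally minimal `W/ℚ` with `j(W) = 0` and good
  reduction at `2`: `#W̃(𝔽₂) = 3`, `frobeniusTrace W 2 = 0`, and the `L`-series coefficient
  `W.LFunction 2 = 0`;
* ★ `lFunction_eq_zero_of_j_eq_zero_of_mod_three_eq_two'` — the merged all-`ℓ` form: for EVERY good
  prime `ℓ ≡ 2 (mod 3)` (now including `ℓ = 2`), `W.LFunction ℓ = 0`.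

USE: discharges the displayed per-curve binder
`h2 : W.HasGoodReductionAtPrime 2 → W.LFunction 2 = 0` of the `j = 0` corner files of cell `bsd-wall`
(`Summits/…/Theorems/BiquadraticEisensteinDescentHeegnerTwistCouplingInSupplyKrizLiCorner*`) and of
cell `bsd-print-cfram` (`PrintCFramJZeroThree*`, `hss_three_of_mordell_int`).

## References

* J. H. Silverman, *The Arithmetic of Elliptic Curves*, 2nd ed., GTM 106 (2009): III.1 (the
  quantities `b₂, b₄, c₄, Δ`), App. A Prop. 1.1(c) (`j = a₁¹²/Δ` in characteristic `2`), Exercise 5.7,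
  V.2 (`a = q + 1 − #E(𝔽_q)`), Exercise 8.19(a) (`c_p = t_p`). [SilvermanAEC2009]
* K. Ireland, M. Rosen, *A Classical Introduction to Modern Number Theory*, 2nd ed., GTM 84 (1990),
  Ch. 18 §3 Thm. 4 (`y² = x³ + D`, `p ≡ 2 (mod 3)`: `N_p = p + 1`). [IrelandRosen1990]

## Mathlib / tree search

Mathlib: `WeierstrassCurve.c₄_of_char_two`, `Δ_of_char_two`, `map_c₄`, `map_Δ`, `map_a₁…a₆`
(`@[simps] map`), `j_eq_zero_iff`, `coe_Δ'`, `ZMod.intCast_zmod_eq_zero_iff_dvd`,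
`ZMod.intCast_cast`/`Int.cast_injective`. Tree: `integralModelInt`, `map_integralModelInt`,
`minimalDiscriminantInt`, `reductionPointCount`, `frobeniusTrace` (`GlobalMinimalModel`);
`not_hasGoodReductionAtPrime_of_dvd_minimalDiscriminantInt` (`NoEverywhereGoodReductionRat`);
`LFunction_apply_prime_eq_frobeniusTrace` (`LFunctionPrimeCoeff`);
`DeuringHasse.natCard_point_eq_card_filter_add_one` (`SupersingularPrimeFieldPointCount`);
`frobeniusTrace_eq_zero_of_j_eq_zero_of_mod_three_eq_two` (`ComplexMultiplicationDeuring0Square`,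
the odd primes `ℓ ≡ 2 (mod 3)` of the merged form); `JZero.lFunction_eq_zero_of_j_eq_zero_of_mod_three_eq_two`
(`JZeroKolyvaginPrimes`, `ℓ ≠ 2`, heavier import closure — not imported).
-/

noncomputable section

open scoped Classical

open WeierstrassCurve Finset

namespace Literature.NumberTheory.EllipticCurves.JZero

/-! ### §1. Integer arithmetic of a Weierstrass equation with `c₄ = 0` -/

/-- **`c₄ = 0 ⟹ 2 ∣ a₁`** for a Weierstrass equation over `ℤ`: modulo `2`, `c₄ ≡ a₁⁴`
(Mathlib `c₄_of_char_two` applied to the reduction modulo `2`). Silverman, *AEC*, III.1 and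
App. A Prop. 1.1(c). [cite: SilvermanAEC2009, III.1 (c₄ = b₂² − 24 b₄) and App. A Prop. 1.1(c)] -/
theorem two_dvd_a₁_of_c₄_eq_zero (V : WeierstrassCurve ℤ) (hc : V.c₄ = 0) : (2 : ℤ) ∣ V.a₁ := by
  set E : WeierstrassCurve (ZMod 2) := V.map (Int.castRingHom (ZMod 2)) with hE
  have h4 : E.a₁ ^ 4 = 0 := by
    rw [← c₄_of_char_two, hE, map_c₄, hc, map_zero]
  have h1 : E.a₁ = 0 := pow_eq_zero_iff (by norm_num) |>.mp h4
  have h1' : ((V.a₁ : ℤ) : ZMod 2) = 0 := by simpa [hE] using h1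
  exact (ZMod.intCast_zmod_eq_zero_iff_dvd V.a₁ 2).mp h1'

/-- **`c₄ = 16((α² + a₂)² − 3(a₄ + α a₃))` when `a₁ = 2α`**, hence `c₄ = 0 ⟹ (α² + a₂)² = 3(a₄ + αa₃)`
(`c₄ = b₂² − 24 b₄`, `b₂ = a₁² + 4a₂ = 4(α² + a₂)`, `b₄ = 2a₄ + a₁a₃ = 2(a₄ + αa₃)`).
Silverman, *AEC*, III.1. [cite: SilvermanAEC2009, III.1 (b₂ = a₁² + 4a₂, b₄ = 2a₄ + a₁a₃, c₄ = b₂² − 24 b₄)] -/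
theorem sq_eq_three_mul_of_c₄_eq_zero (V : WeierstrassCurve ℤ) (hc : V.c₄ = 0) {α : ℤ}
    (hα : V.a₁ = 2 * α) : (α ^ 2 + V.a₂) ^ 2 = 3 * (V.a₄ + α * V.a₃) := by
  have h16 : (16 : ℤ) * ((α ^ 2 + V.a₂) ^ 2 - 3 * (V.a₄ + α * V.a₃)) = 0 := by
    rw [← hc]
    simp only [WeierstrassCurve.c₄, WeierstrassCurve.b₂, WeierstrassCurve.b₄, hα]
    ring
  have h := (mul_eq_zero.mp h16).resolve_left (by norm_num)
  linarith

/-- **`2 ∣ a₁` and `2 ∤ Δ` ⟹ `a₃` is odd** (`a₃ = 1` in `ℤ/2`): modulo `2`, with `a₁ ≡ 0`,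
`Δ ≡ a₃⁴` (Mathlib `Δ_of_char_two`). Silverman, *AEC*, III.1, App. A Prop. 1.1(c).
[cite: SilvermanAEC2009, App. A Prop. 1.1(c) (Δ in characteristic 2) and III.1] -/
theorem intCast_a₃_eq_one_of_two_dvd_a₁ (V : WeierstrassCurve ℤ) (h1 : (2 : ℤ) ∣ V.a₁)
    (hΔ : ¬ (2 : ℤ) ∣ V.Δ) : ((V.a₃ : ℤ) : ZMod 2) = 1 := by
  set E : WeierstrassCurve (ZMod 2) := V.map (Int.castRingHom (ZMod 2)) with hE
  have hE1 : E.a₁ = 0 := by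
    show (Int.castRingHom (ZMod 2)) V.a₁ = 0
    rw [eq_intCast, ZMod.intCast_zmod_eq_zero_iff_dvd]
    exact h1
  have hEΔ : E.Δ ≠ 0 := by
    rw [hE, map_Δ, eq_intCast, Ne, ZMod.intCast_zmod_eq_zero_iff_dvd]
    exact hΔ
  have hΔ3 : E.Δ = E.a₃ ^ 4 := by
    rw [Δ_of_char_two, hE1]; ring
  have h3 : E.a₃ ≠ 0 := by
    intro h0
    exact hEΔ (by rw [hΔ3, h0]; ring)
  have h3' : ((V.a₃ : ℤ) : ZMod 2) ≠ 0 := by simpa [hE] using h3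
  revert h3'
  generalize ((V.a₃ : ℤ) : ZMod 2) = x
  decide +revert

/-- **`c₄ = 0` and `2 ∤ Δ` ⟹ `a₃` odd.** [cite: SilvermanAEC2009, App. A Prop. 1.1(c) and III.1] -/
theorem intCast_a₃_eq_one_of_c₄_eq_zero (V : WeierstrassCurve ℤ) (hc : V.c₄ = 0)
    (hΔ : ¬ (2 : ℤ) ∣ V.Δ) : ((V.a₃ : ℤ) : ZMod 2) = 1 :=
  intCast_a₃_eq_one_of_two_dvd_a₁ V (two_dvd_a₁_of_c₄_eq_zero V hc) hΔ

/-- **`c₄ = 0` and `2 ∤ Δ` ⟹ `a₂ ≡ a₄ (mod 2)`**: with `a₁ = 2α` and `a₃` odd, reducing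
`(α² + a₂)² = 3(a₄ + αa₃)` modulo `2` gives `α + a₂ ≡ a₄ + α`. Silverman, *AEC*, III.1.
[cite: SilvermanAEC2009, III.1 (c₄) and App. A Prop. 1.1(c)] -/
theorem intCast_a₂_eq_intCast_a₄_of_c₄_eq_zero (V : WeierstrassCurve ℤ) (hc : V.c₄ = 0)
    (hΔ : ¬ (2 : ℤ) ∣ V.Δ) : ((V.a₂ : ℤ) : ZMod 2) = ((V.a₄ : ℤ) : ZMod 2) := by
  obtain ⟨α, hα⟩ := two_dvd_a₁_of_c₄_eq_zero V hc
  have h3 := intCast_a₃_eq_one_of_c₄_eq_zero V hc hΔ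
  have hsq := sq_eq_three_mul_of_c₄_eq_zero V hc hα
  have hcast : (((α ^ 2 + V.a₂) ^ 2 : ℤ) : ZMod 2) = ((3 * (V.a₄ + α * V.a₃) : ℤ) : ZMod 2) := by
    rw [hsq]
  push_cast at hcast
  rw [h3] at hcast
  revert hcast
  generalize ((α : ℤ) : ZMod 2) = x
  generalize ((V.a₂ : ℤ) : ZMod 2) = a
  generalize ((V.a₄ : ℤ) : ZMod 2) = b
  decide +revert

/-! ### §2. The point count over `𝔽₂` -/

/-- **Over `𝔽₂`, `y² + y = x³ + a x² + a x + b` has exactly `3` points** (two affine points and `O`):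
for `x = 0, 1` the right-hand side is `b`, `1 + b`, and `y² + y = c` has two solutions for `c = 0`,
none for `c = 1`. Silverman, *AEC*, V.2 (definition of `#E(𝔽_q)`), Exercise 5.7.
[cite: SilvermanAEC2009, V.2 and Exercise 5.7] -/
theorem natCard_point_eq_three (E : WeierstrassCurve (ZMod 2)) [E.IsElliptic] (h1 : E.a₁ = 0)
    (h3 : E.a₃ = 1) (h24 : E.a₂ = E.a₄) : Nat.card E.toAffine.Point = 3 := by
  rw [DeuringHasse.natCard_point_eq_card_filter_add_one E, h1, h3, h24]
  have key : ∀ a b : ZMod 2, (univ.filter fun xy : ZMod 2 × ZMod 2 =>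
      xy.2 ^ 2 + 0 * xy.1 * xy.2 + 1 * xy.2 = xy.1 ^ 3 + a * xy.1 ^ 2 + a * xy.1 + b).card = 2 := by
    decide
  rw [key]

/-! ### §3. Globally minimal `j = 0` curves over `ℚ` with good reduction at `2` -/

variable (W : WeierstrassCurve ℚ) [W.IsElliptic] [W.IsGloballyMinimal]

/-- `j(W) = 0 ⟹ c₄ = 0` for the integral model over `ℤ` (`j = c₄³/Δ`; `ℤ → ℚ` is injective).
[cite: SilvermanAEC2009, III.1 (j = c₄³/Δ) and VIII.8 (global minimal model)] -/
theorem integralModelInt_c₄_eq_zero (hj : W.j = 0) : (integralModelInt W).c₄ = 0 := by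
  have h0 : W.c₄ = 0 := W.j_eq_zero_iff.mp hj
  have hc : (((integralModelInt W).c₄ : ℤ) : ℚ) = W.c₄ := by
    have h := (integralModelInt W).map_c₄ (Int.castRingHom ℚ)
    rw [map_integralModelInt, eq_intCast] at h
    exact h.symm
  exact_mod_cast hc.trans h0

omit [W.IsElliptic] in
/-- Good reduction at `2` ⟹ `2 ∤ Δ_min(W)` (contrapositive of the tree's
`not_hasGoodReductionAtPrime_of_dvd_minimalDiscriminantInt`). Silverman, *AEC*, VII.5 Prop. 5.1(a).
[cite: SilvermanAEC2009, VII.5 Prop. 5.1(a) and VII.1 Prop. 1.3(b)] -/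
theorem not_two_dvd_minimalDiscriminantInt (h : W.HasGoodReductionAtPrime 2) :
    ¬ (2 : ℤ) ∣ minimalDiscriminantInt W := fun hd =>
  not_hasGoodReductionAtPrime_of_dvd_minimalDiscriminantInt W 2 (by exact_mod_cast hd) h

/-- ★ **`#W̃(𝔽₂) = 3` for a globally minimal `W/ℚ` with `j(W) = 0` and good reduction at `2`.**
The reduction of the minimal equation is `y² + y = x³ + a x² + a x + b` over `𝔽₂` (`a₁` even,
`a₃` odd, `a₂ ≡ a₄`), which has three points. Silverman, *AEC*, V.2, Ex. 5.7; Ireland–Rosen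
Ch. 18 §3 Thm. 4 (`N_p = p + 1` at `p ≡ 2 (mod 3)`), here at `p = 2`.
[cite: IrelandRosen1990, Ch. 18 §3, Theorem 4] -/
theorem reductionPointCount_two_eq_three (hj : W.j = 0) (h : W.HasGoodReductionAtPrime 2) :
    reductionPointCount W 2 = 3 := by
  have hc := integralModelInt_c₄_eq_zero W hj
  have hΔ : ¬ (2 : ℤ) ∣ (integralModelInt W).Δ := not_two_dvd_minimalDiscriminantInt W h
  set E : WeierstrassCurve (ZMod 2) := (integralModelInt W).map (Int.castRingHom (ZMod 2)) with hE
  haveI : E.IsElliptic := by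
    rw [isElliptic_iff, hE, map_Δ, isUnit_iff_ne_zero, eq_intCast, Ne,
      ZMod.intCast_zmod_eq_zero_iff_dvd]
    exact hΔ
  have h1 : E.a₁ = 0 := by
    show (Int.castRingHom (ZMod 2)) (integralModelInt W).a₁ = 0
    rw [eq_intCast, ZMod.intCast_zmod_eq_zero_iff_dvd]
    exact two_dvd_a₁_of_c₄_eq_zero _ hc
  have h3 : E.a₃ = 1 := by
    show (Int.castRingHom (ZMod 2)) (integralModelInt W).a₃ = 1
    rw [eq_intCast]
    exact intCast_a₃_eq_one_of_c₄_eq_zero _ hc hΔ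
  have h24 : E.a₂ = E.a₄ := by
    show (Int.castRingHom (ZMod 2)) (integralModelInt W).a₂ =
      (Int.castRingHom (ZMod 2)) (integralModelInt W).a₄
    rw [eq_intCast, eq_intCast]
    exact intCast_a₂_eq_intCast_a₄_of_c₄_eq_zero _ hc hΔ
  show Nat.card E.toAffine.Point = 3
  exact natCard_point_eq_three E h1 h3 h24

/-- ★ **`a₂(W) = 0`**: the trace of Frobenius at `2` of a globally minimal `W/ℚ` with `j(W) = 0` and
good reduction at `2` vanishes (`2 + 1 − #W̃(𝔽₂) = 0`: supersingular reduction at the prime `2`,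
which is inert in the CM field `ℚ(√−3)`). Deuring; Ireland–Rosen Ch. 18 §3 Thm. 4 at `p = 2`.
[cite: IrelandRosen1990, Ch. 18 §3, Theorem 4] -/
theorem frobeniusTrace_two_eq_zero_of_j_eq_zero (hj : W.j = 0) (h : W.HasGoodReductionAtPrime 2) :
    frobeniusTrace W 2 = 0 := by
  rw [frobeniusTrace, reductionPointCount_two_eq_three W hj h]
  norm_num

/-- ★ **The `2`nd coefficient of `L(W, s)` vanishes** for a globally minimal `W/ℚ` with `j(W) = 0`
and good reduction at `2` (Silverman, *AEC*, Ex. 8.19(a): `c_p = t_p` at a good prime, the tree's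
`LFunction_apply_prime_eq_frobeniusTrace`). This is the binder
`W.HasGoodReductionAtPrime 2 → W.LFunction 2 = 0` of the tree's `j = 0` corner files, discharged.
[cite: IrelandRosen1990, Ch. 18 §3, Theorem 4] -/
theorem lFunction_two_eq_zero_of_j_eq_zero (hj : W.j = 0) (h : W.HasGoodReductionAtPrime 2) :
    W.LFunction 2 = 0 := by
  rw [W.LFunction_apply_prime_eq_frobeniusTrace 2 h, frobeniusTrace_two_eq_zero_of_j_eq_zero W hj h]

/-- The binder in the exact displayed shape of the corner files
(`(haveI : Fact (Nat.Prime 2) := ⟨Nat.prime_two⟩; W.HasGoodReductionAtPrime 2) → W.LFunction 2 = 0`),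
for a globally minimal `W` with `j(W) = 0`. [cite: IrelandRosen1990, Ch. 18 §3, Theorem 4] -/
theorem lFunction_two_eq_zero_binder (hj : W.j = 0) :
    (haveI : Fact (Nat.Prime 2) := ⟨Nat.prime_two⟩; W.HasGoodReductionAtPrime 2) →
      W.LFunction 2 = 0 :=
  fun h => lFunction_two_eq_zero_of_j_eq_zero W hj h

/-- The same binder for a globally minimal `W` given as `C • W = W₀` with `W₀.c₄ = 0` (e.g.
`W₀ = y² = x³ + k`, a Mordell curve: `j` is invariant under variable changes and `j = 0 ⟺ c₄ = 0`).
[cite: IrelandRosen1990, Ch. 18 §3, Theorem 4] -/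
theorem lFunction_two_eq_zero_binder_of_smul_c₄_eq_zero {C : VariableChange ℚ} {W₀ : WeierstrassCurve ℚ}
    (hW : C • W = W₀) (hc : W₀.c₄ = 0) :
    (haveI : Fact (Nat.Prime 2) := ⟨Nat.prime_two⟩; W.HasGoodReductionAtPrime 2) →
      W.LFunction 2 = 0 := by
  refine lFunction_two_eq_zero_binder W ?_
  have h1 : (C • W).j = W.j := variableChange_j W C
  have h2 : (C • W).j = 0 := by
    have hc4 : (C • W).c₄ = 0 := by rw [hW, hc]
    rw [WeierstrassCurve.j, hc4]; simp
  rw [← h1, h2]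

/-- ★ **`a_ℓ(W) = 0` for EVERY good prime `ℓ ≡ 2 (mod 3)` of a globally minimal `W/ℚ` with
`j(W) = 0`** — the primes inert in the CM field `ℚ(√−3)`, now INCLUDING `ℓ = 2`: the `ℓ`-th
coefficient of `L(W, s)` vanishes. The odd case is the tree's
`frobeniusTrace_eq_zero_of_j_eq_zero_of_mod_three_eq_two` (Ireland–Rosen Ch. 18 §3 Thm. 4:
`x ↦ x³` permutes `𝔽_ℓ`), the case `ℓ = 2` is `lFunction_two_eq_zero_of_j_eq_zero`.
[cite: IrelandRosen1990, Ch. 18 §3, Theorem 4] -/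
theorem lFunction_eq_zero_of_j_eq_zero_of_mod_three_eq_two' (hj : W.j = 0) {ℓ : ℕ} [Fact ℓ.Prime]
    (hℓ3 : ℓ % 3 = 2) (h : W.HasGoodReductionAtPrime ℓ) : W.LFunction ℓ = 0 := by
  by_cases hℓ2 : ℓ = 2
  · subst hℓ2
    exact lFunction_two_eq_zero_of_j_eq_zero W hj h
  · have hΔ : ¬ (ℓ : ℤ) ∣ minimalDiscriminantInt W := fun hd =>
      not_hasGoodReductionAtPrime_of_dvd_minimalDiscriminantInt W ℓ hd h
    rw [W.LFunction_apply_prime_eq_frobeniusTrace ℓ h,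
      frobeniusTrace_eq_zero_of_j_eq_zero_of_mod_three_eq_two W hj (Fact.out) hℓ3 hℓ2 hΔ]

end Literature.NumberTheory.EllipticCurves.JZero

end
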